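import Summits.PneNP.PneNP.Theorems.SymmetryBudgetNoHiddenOrderPerPathCGComplete

/-!
# Global pass-over HEIGHTS on the solution subtree of the concrete process (`NoHiddenOrder`, glue g3a)

Route `PneNP/SymmetryBudget`, `NoHiddenOrder` (stmt-PneNP-14781). The certified-label scheme over the components-only Corneil–Goldberg
process (`cgProcess`, `cgValuation`; completeness `cg_val_ne_none_of_reach` with BLOCK SIZES as values, `…PerPathCGComplete.lean`) needs,
for a linear label budget, values of linear total code length along every path. PER-PATH.md §12 / ANALYSIS-4 Lemma C: take the
PASS-OVER HEIGHT. Here, for any selector `sel` choosing inside the first smallest cell: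

* `desc G sel I` — the instances of the solution subtree strictly below `I` (all parts at section nodes, the selected child at
  individualisation nodes), by well-founded recursion on `canonMeasure`; `mem_desc_of_reachFrom` — `ReachFrom` lands in `desc`;
* `hgt G sel I := 1 + max {hgt β : β ∈ desc I, sel β ∈ smallestCell I}` at individualisation nodes (`0` elsewhere) — the length
  of the longest pass-over chain from `I`; **(C1′) holds by construction** (`hgt_lt_of_reachFrom`), so `cg_val_ne_none_of_reach_hgt`:
  completeness of the scheme with heights as values (`cg_val_ne_none_of_reach_hgt'`: value range `|V|`), admissibility the only
  hypothesis left;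
* invariants down the solution subtree (`desc_block_subset_and_refines`, `cellOf_eq_singleton_of_mem_desc`) and the VALUE BOUND
  **`hgt_le_card_smallestCell_sub_one`**: `hgt I ≤ |smallestCell I| − 1` — a pass-over chain from `I` names distinct vertices of the cell
  of `I` other than `sel I` (cells only refine and restrict downwards). With the per-path bound `Σ log₂ |smallestCell| = O(|V|)`
  (`ORSteps.sum_log_d_le`) this is the linear code length of height labels; the transfer of that bound to `Reach`-paths is glue g3b.
-/

-- `Summit.PneNP.PneNP.…` duplicates `PneNP` BY DESIGN (single-problem summit, D-0017 layout).
set_option linter.dupNamespace false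

namespace Summit.PneNP.PneNP.Theorems

open Finset

namespace BranchSum

variable {V : Type*} [DecidableEq V] (G : SimpleGraph V) [DecidableRel G.Adj]

/-- The conditions of the case distinction of `cgStep`, named. -/
theorem cgStep_eq_orNode_of {I : CGInst V} (hAND : ¬ ∃ u ∈ I.1.1, swReach G I.1.1 I.1.2 u ≠ I.1.1)
    (hOR : 1 < I.1.1.card ∧ 2 ≤ (smallestCell I.1.1 I.1.2).card) :
    cgStep G I = .orNode (smallestCell I.1.1 I.1.2) (cgChild G I) :=
  cgStep_eq_orNode_iff.2 ⟨hAND, hOR, rfl, rfl⟩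

/-- The measure drops to the child at a vertex of the first smallest cell of an individualisation node. -/
theorem canonMeasure_cgChild_lt {I : CGInst V} (hOR : 1 < I.1.1.card ∧ 2 ≤ (smallestCell I.1.1 I.1.2).card) {x : V}
    (hx : x ∈ smallestCell I.1.1 I.1.2) :
    canonMeasure (cgChild G I x).1.1 (cgChild G I x).1.2 < canonMeasure I.1.1 I.1.2 := by
  have h2 : 2 ≤ (cellOf I.1.1 I.1.2 x).card := by rw [← smallestCell_eq_cellOf _ hx]; exact hOR.2
  exact canonMeasure_lt_refineIn_indiv (G := G) I.1.2 (smallestCell_subset _ _ hx) h2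

/-- The measure drops to every part of a section node. -/
theorem canonMeasure_part_lt {I : CGInst V} (hAND : ∃ u ∈ I.1.1, swReach G I.1.1 I.1.2 u ≠ I.1.1) {J : CGInst V}
    (hJ : J ∈ cgParts G I) : canonMeasure J.1.1 J.1.2 < canonMeasure I.1.1 I.1.2 :=
  canonMeasure_lt_of_card_lt _ _ (card_lt_card (cgParts_ssubset hAND hJ))

variable [DecidableEq (CGInst V)]

/-- **The solution subtree strictly below `I`** for the selector `sel`: all parts at section nodes, the selected child at
individualisation nodes (guarded by `sel I ∈ smallestCell`, which holds for selectors choosing in the cell). -/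
noncomputable def desc (sel : CGInst V → V) (I : CGInst V) : Finset (CGInst V) :=
  if _hAND : ∃ u ∈ I.1.1, swReach G I.1.1 I.1.2 u ≠ I.1.1 then
    (cgParts G I).attach.biUnion fun J => insert J.1 (desc sel J.1)
  else if _hOR : 1 < I.1.1.card ∧ 2 ≤ (smallestCell I.1.1 I.1.2).card then
    if _hx : sel I ∈ smallestCell I.1.1 I.1.2 then insert (cgChild G I (sel I)) (desc sel (cgChild G I (sel I))) else ∅
  else ∅
termination_by canonMeasure I.1.1 I.1.2
decreasing_by
  · exact canonMeasure_part_lt G _hAND J.2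
  · exact canonMeasure_cgChild_lt G _hOR _hx

variable {G}

/-- `desc` at a section node. -/
theorem mem_desc_andNode {sel : CGInst V → V} {I : CGInst V} (hAND : ∃ u ∈ I.1.1, swReach G I.1.1 I.1.2 u ≠ I.1.1)
    {β : CGInst V} : β ∈ desc G sel I ↔ ∃ J ∈ cgParts G I, β = J ∨ β ∈ desc G sel J := by
  rw [desc, dif_pos hAND, mem_biUnion]
  constructor
  · rintro ⟨⟨J, hJ⟩, -, h⟩
    exact ⟨J, hJ, mem_insert.1 h⟩
  · rintro ⟨J, hJ, h⟩
    exact ⟨⟨J, hJ⟩, mem_attach _ _, mem_insert.2 h⟩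

/-- `desc` at an individualisation node of a selector choosing in the cell. -/
theorem mem_desc_orNode {sel : CGInst V → V} {I : CGInst V} (hAND : ¬ ∃ u ∈ I.1.1, swReach G I.1.1 I.1.2 u ≠ I.1.1)
    (hOR : 1 < I.1.1.card ∧ 2 ≤ (smallestCell I.1.1 I.1.2).card) (hx : sel I ∈ smallestCell I.1.1 I.1.2) {β : CGInst V} :
    β ∈ desc G sel I ↔ β = cgChild G I (sel I) ∨ β ∈ desc G sel (cgChild G I (sel I)) := by
  rw [desc, dif_neg hAND, dif_pos hOR, dif_pos hx, mem_insert]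

/-- `desc` at a leaf. -/
theorem desc_leaf {sel : CGInst V → V} {I : CGInst V} (hAND : ¬ ∃ u ∈ I.1.1, swReach G I.1.1 I.1.2 u ≠ I.1.1)
    (hOR : ¬ (1 < I.1.1.card ∧ 2 ≤ (smallestCell I.1.1 I.1.2).card)) : desc G sel I = ∅ := by
  rw [desc, dif_neg hAND, dif_neg hOR]

/-- The measure drops along `desc`. -/
theorem canonMeasure_lt_of_mem_desc (sel : CGInst V → V) (I : CGInst V) :
    ∀ β ∈ desc G sel I, canonMeasure β.1.1 β.1.2 < canonMeasure I.1.1 I.1.2 := by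
  induction hn : canonMeasure I.1.1 I.1.2 using Nat.strong_induction_on generalizing I with
  | _ n ih =>
  intro β hβ
  by_cases hAND : ∃ u ∈ I.1.1, swReach G I.1.1 I.1.2 u ≠ I.1.1
  · obtain ⟨J, hJ, hβ⟩ := (mem_desc_andNode hAND).1 hβ
    have hJlt := canonMeasure_part_lt G hAND hJ
    rcases hβ with rfl | hβ
    · exact hn ▸ hJlt
    · exact hn ▸ (ih _ (hn ▸ hJlt) J rfl β hβ).trans hJlt
  · by_cases hOR : 1 < I.1.1.card ∧ 2 ≤ (smallestCell I.1.1 I.1.2).card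
    · by_cases hx : sel I ∈ smallestCell I.1.1 I.1.2
      · have hClt := canonMeasure_cgChild_lt G hOR hx
        rcases (mem_desc_orNode hAND hOR hx).1 hβ with rfl | hβ
        · exact hn ▸ hClt
        · exact hn ▸ (ih _ (hn ▸ hClt) _ rfl β hβ).trans hClt
      · rw [desc, dif_neg hAND, dif_pos hOR, dif_neg hx] at hβ
        exact absurd hβ (notMem_empty β)
    · rw [desc_leaf hAND hOR] at hβ
      exact absurd hβ (notMem_empty β)

variable (G)

/-- **The PASS-OVER HEIGHT** of an instance in the solution subtree: at an individualisation node, one more than the largest height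
of a node below whose selected vertex lies in the cell; `0` at other nodes. -/
noncomputable def hgt (sel : CGInst V → V) (I : CGInst V) : ℕ :=
  if ∃ u ∈ I.1.1, swReach G I.1.1 I.1.2 u ≠ I.1.1 then 0
  else if 1 < I.1.1.card ∧ 2 ≤ (smallestCell I.1.1 I.1.2).card then
    1 + ((desc G sel I).filter fun β => sel β ∈ smallestCell I.1.1 I.1.2).attach.sup fun β => hgt sel β.1
  else 0
termination_by canonMeasure I.1.1 I.1.2
decreasing_by
  exact canonMeasure_lt_of_mem_desc sel I β.1 (mem_filter.1 β.2).1

variable {G}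

/-! ### `ReachFrom` lands in `desc`; (C1′) for the heights -/

/-- A node reached from `I` in the solution subtree of a selector choosing in the cell (head-step form, any recorded values) is
`I` or lies in `desc I`. -/
theorem mem_desc_of_reachFrom {sel : CGInst V → V} (hsel : ∀ I A ch, cgStep G I = .orNode A ch → sel I ∈ A)
    {hv : CGInst V → ℕ} {I : (cgProcess G).Inst} {X : Finset V} {lam : V → ℕ} {ν : (cgProcess G).Inst} {Xν : Finset V}
    {lamν : V → ℕ} (h : CertifiedLabels.ReachFrom (P := cgProcess G) sel hv I X lam ν Xν lamν) :
    ν = I ∨ ν ∈ desc G sel I := by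
  induction h with
  | refl => exact Or.inl rfl
  | @part I X lam ps J ν Xν lamν hs hJ _ ih =>
    change CGInst V at I J ν
    right
    obtain ⟨hAND, rfl⟩ := cgStep_eq_andNode_iff.1 hs
    exact (mem_desc_andNode hAND).2 ⟨J, hJ, ih⟩
  | @child I X lam A ch ν Xν lamν hs _ ih =>
    change CGInst V at I ν
    right
    have hx := hsel I A ch hs
    obtain ⟨hAND, hOR, rfl, rfl⟩ := cgStep_eq_orNode_iff.1 hs
    exact (mem_desc_orNode hAND hOR hx).2 ih

/-- `hgt` at an individualisation node. -/
theorem hgt_eq_of_orNode (sel : CGInst V → V) {I : CGInst V} (hAND : ¬ ∃ u ∈ I.1.1, swReach G I.1.1 I.1.2 u ≠ I.1.1)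
    (hOR : 1 < I.1.1.card ∧ 2 ≤ (smallestCell I.1.1 I.1.2).card) :
    hgt G sel I = 1 + ((desc G sel I).filter fun β => sel β ∈ smallestCell I.1.1 I.1.2).attach.sup fun β => hgt G sel β.1 := by
  rw [hgt, if_neg hAND, if_pos hOR]

/-- `hgt` vanishes off individualisation nodes. -/
theorem hgt_eq_zero_of_not_orNode (sel : CGInst V → V) {I : CGInst V}
    (h : (∃ u ∈ I.1.1, swReach G I.1.1 I.1.2 u ≠ I.1.1) ∨ ¬ (1 < I.1.1.card ∧ 2 ≤ (smallestCell I.1.1 I.1.2).card)) :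
    hgt G sel I = 0 := by
  rw [hgt]
  split_ifs with h1 h2
  · rfl
  · exact (h.elim h1 fun hB => hB h2).elim
  · rfl

/-- At an individualisation node, a node below with selected vertex in the cell has smaller height. -/
theorem hgt_lt_of_mem_desc {sel : CGInst V → V} {I : CGInst V} {A : Finset V} {ch : V → CGInst V}
    (hs : cgStep G I = .orNode A ch) {β : CGInst V} (hβ : β ∈ desc G sel I) (hβA : sel β ∈ A) :
    hgt G sel β < hgt G sel I := by
  obtain ⟨hAND, hOR, rfl, rfl⟩ := cgStep_eq_orNode_iff.1 hs
  rw [hgt_eq_of_orNode sel hAND hOR]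
  have hmem : β ∈ (desc G sel I).filter fun β => sel β ∈ smallestCell I.1.1 I.1.2 := mem_filter.2 ⟨hβ, hβA⟩
  have hle : hgt G sel β ≤ ((desc G sel I).filter fun β => sel β ∈ smallestCell I.1.1 I.1.2).attach.sup fun β => hgt G sel β.1 :=
    le_sup (f := fun β : {β // β ∈ (desc G sel I).filter fun β => sel β ∈ smallestCell I.1.1 I.1.2} => hgt G sel β.1)
      (mem_attach _ ⟨β, hmem⟩)
  omega

/-- **(C1′) for the heights**: below the child of an individualisation node `I`, a node whose selected vertex lies in the cell of
`I` has smaller height. -/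
theorem hgt_lt_of_reachFrom {sel : CGInst V → V} (hsel : ∀ I A ch, cgStep G I = .orNode A ch → sel I ∈ A)
    {hv : CGInst V → ℕ} (I : CGInst V) (A : Finset V) (ch : V → CGInst V) (hs : cgStep G I = .orNode A ch)
    {X' : Finset V} {lam' : V → ℕ} {β : CGInst V} {Xβ : Finset V} {lamβ : V → ℕ}
    (hR : CertifiedLabels.ReachFrom (P := cgProcess G) sel hv (ch (sel I)) X' lam' β Xβ lamβ) (hβA : sel β ∈ A) :
    hgt G sel β < hgt G sel I := by
  refine hgt_lt_of_mem_desc hs ?_ hβA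
  have hx := hsel I A ch hs
  obtain ⟨hAND, hOR, rfl, rfl⟩ := cgStep_eq_orNode_iff.1 hs
  exact (mem_desc_orNode hAND hOR hx).2 (mem_desc_of_reachFrom hsel hR)

/-- **Completeness with HEIGHTS as values**, admissibility and the value range the only hypotheses left. -/
theorem cg_val_ne_none_of_reach_hgt [Fintype V] (adm : CertifiedLabels.Label V → Prop) (g : ℕ) (I₀ : CGInst V)
    (hadm : ∀ I X lam, CertifiedLabels.Reach (cgProcess G) (cgSel (V := V)) (hgt G cgSel) I₀ I X lam → adm ⟨I.1.1, X, lam⟩)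
    (hg : ∀ I A ch, cgStep G I = .orNode A ch → hgt G cgSel I < g)
    (I : CGInst V) (X : Finset V) (lam : V → ℕ)
    (h : CertifiedLabels.Reach (cgProcess G) (cgSel (V := V)) (hgt G cgSel) I₀ I X lam) :
    CertifiedLabels.val (cgProcess G) (cgValuation G) (fun L => CertifiedLabels.replay (cgProcess G) L I₀ ∅) adm g
      ⟨I.1.1, X, lam⟩ ≠ none := by
  refine CertifiedLabels.val_complete_replay (cgValuation G) adm _ (cgSel (V := V)) (hgt G cgSel) I₀ cgSel_mem
    hg (fun I A ch hs => ?_) (fun I X lam A ch hR hs => ?_) hadm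
    cgStep_parts_disjoint verts_nonempty (fun I X lam A ch _ hs β Xβ lamβ Aβ chβ hR _ hβA => ?_) I X lam h
  · obtain ⟨-, -, -, rfl⟩ := cgStep_eq_orNode_iff.1 hs
    rfl
  · exact cgSel_fresh cgSel_mem I X lam A ch hR hs
  · exact hgt_lt_of_reachFrom cgSel_mem I A ch hs hR hβA

/-! ### Invariants down the solution subtree and the value bound -/

/-- Down the solution subtree blocks shrink and colourings refine. -/
theorem desc_block_subset_and_refines (sel : CGInst V → V) (I : CGInst V) :
    ∀ β ∈ desc G sel I, β.1.1 ⊆ I.1.1 ∧ ∀ u ∈ β.1.1, ∀ v ∈ β.1.1, β.1.2 u = β.1.2 v → I.1.2 u = I.1.2 v := by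
  induction hn : canonMeasure I.1.1 I.1.2 using Nat.strong_induction_on generalizing I with
  | _ n ih =>
  intro β hβ
  by_cases hAND : ∃ u ∈ I.1.1, swReach G I.1.1 I.1.2 u ≠ I.1.1
  · obtain ⟨J, hJ, hβ⟩ := (mem_desc_andNode hAND).1 hβ
    have hJlt := canonMeasure_part_lt G hAND hJ
    have hJI : J.1.1 ⊆ I.1.1 := (cgParts_ssubset hAND hJ).1
    have hcol : J.1.2 = I.1.2 := (mem_cgParts_iff.1 hJ).1
    rcases hβ with rfl | hβ
    · exact ⟨hJI, fun u _ v _ huv => hcol ▸ huv⟩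
    · obtain ⟨h1, h2⟩ := ih _ (hn ▸ hJlt) J rfl β hβ
      exact ⟨h1.trans hJI, fun u hu v hv huv => hcol ▸ h2 u hu v hv huv⟩
  · by_cases hOR : 1 < I.1.1.card ∧ 2 ≤ (smallestCell I.1.1 I.1.2).card
    · by_cases hx : sel I ∈ smallestCell I.1.1 I.1.2
      · have hClt := canonMeasure_cgChild_lt G hOR hx
        -- the child refines `I` on the same block
        have hC : (cgChild G I (sel I)).1.1 ⊆ I.1.1 ∧ ∀ u ∈ (cgChild G I (sel I)).1.1, ∀ v ∈ (cgChild G I (sel I)).1.1,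
            (cgChild G I (sel I)).1.2 u = (cgChild G I (sel I)).1.2 v → I.1.2 u = I.1.2 v :=
          ⟨Subset.rfl, fun u hu v hv huv => indiv_refines _ _ (refineIn_refines (G := G) _ hu hv huv)⟩
        rcases (mem_desc_orNode hAND hOR hx).1 hβ with rfl | hβ
        · exact hC
        · obtain ⟨h1, h2⟩ := ih _ (hn ▸ hClt) _ rfl β hβ
          exact ⟨h1.trans hC.1, fun u hu v hv huv => hC.2 u (h1 hu) v (h1 hv) (h2 u hu v hv huv)⟩
      · rw [desc, dif_neg hAND, dif_pos hOR, dif_neg hx] at hβ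
        exact absurd hβ (notMem_empty β)
    · rw [desc_leaf hAND hOR] at hβ
      exact absurd hβ (notMem_empty β)

/-- A vertex alone in its cell stays alone in its cell down the solution subtree. -/
theorem cellOf_eq_singleton_of_mem_desc (sel : CGInst V → V) {I β : CGInst V} (hβ : β ∈ desc G sel I) {x : V}
    (hxI : cellOf I.1.1 I.1.2 x = {x}) (hxβ : x ∈ β.1.1) : cellOf β.1.1 β.1.2 x = {x} := by
  obtain ⟨hsub, href⟩ := desc_block_subset_and_refines sel I β hβ
  refine eq_singleton_iff_unique_mem.2 ⟨mem_cellOf_iff.2 ⟨hxβ, rfl⟩, fun y hy => ?_⟩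
  rw [mem_cellOf_iff] at hy
  have : y ∈ cellOf I.1.1 I.1.2 x := mem_cellOf_iff.2 ⟨hsub hy.1, href y hy.1 x hxβ hy.2⟩
  rw [hxI] at this
  exact mem_singleton.1 this

/-- **The value bound**: the height of a node is less than the size of its first smallest cell — a pass-over chain from `I`
names distinct vertices of the cell of `I` other than `sel I`. -/
theorem hgt_le_card_smallestCell_sub_one {sel : CGInst V → V} (hsel : ∀ I A ch, cgStep G I = .orNode A ch → sel I ∈ A)
    (I : CGInst V) : hgt G sel I ≤ (smallestCell I.1.1 I.1.2).card - 1 := by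
  induction hn : canonMeasure I.1.1 I.1.2 using Nat.strong_induction_on generalizing I with
  | _ n ih =>
  by_cases hAND : ∃ u ∈ I.1.1, swReach G I.1.1 I.1.2 u ≠ I.1.1
  · rw [hgt_eq_zero_of_not_orNode sel (Or.inl hAND)]; exact Nat.zero_le _
  by_cases hOR : 1 < I.1.1.card ∧ 2 ≤ (smallestCell I.1.1 I.1.2).card
  swap
  · rw [hgt_eq_zero_of_not_orNode sel (Or.inr hOR)]; exact Nat.zero_le _
  have hx : sel I ∈ smallestCell I.1.1 I.1.2 := hsel I _ _ (cgStep_eq_orNode_of G hAND hOR)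
  have hxA : sel I ∈ I.1.1 := smallestCell_subset _ _ hx
  rw [hgt_eq_of_orNode sel hAND hOR]
  suffices hD : ∀ β ∈ (desc G sel I).filter (fun β => sel β ∈ smallestCell I.1.1 I.1.2),
      hgt G sel β ≤ (smallestCell I.1.1 I.1.2).card - 2 by
    have hsup : ((desc G sel I).filter fun β => sel β ∈ smallestCell I.1.1 I.1.2).attach.sup (fun β => hgt G sel β.1) ≤
        (smallestCell I.1.1 I.1.2).card - 2 :=
      Finset.sup_le fun β _ => hD β.1 β.2
    omega
  intro β hβD
  obtain ⟨hβ, hβC⟩ := mem_filter.1 hβD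
  by_cases hβOR : (∃ u ∈ β.1.1, swReach G β.1.1 β.1.2 u ≠ β.1.1) ∨ ¬ (1 < β.1.1.card ∧ 2 ≤ (smallestCell β.1.1 β.1.2).card)
  · rw [hgt_eq_zero_of_not_orNode sel hβOR]; exact Nat.zero_le _
  rw [not_or, not_not] at hβOR
  obtain ⟨hβAND, hβOR⟩ := hβOR
  -- `β` is an individualisation node below `I` selecting in the cell of `I`: its cell lies in that cell minus `sel I`
  have hIH := ih _ (hn ▸ canonMeasure_lt_of_mem_desc sel I β hβ) β rfl
  have hselβ : sel β ∈ smallestCell β.1.1 β.1.2 := hsel β _ _ (cgStep_eq_orNode_of G hβAND hβOR)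
  obtain ⟨hsub, href⟩ := desc_block_subset_and_refines sel I β hβ
  have hCsub : smallestCell β.1.1 β.1.2 ⊆ (smallestCell I.1.1 I.1.2).erase (sel I) := by
    intro y hy
    have hy' := hy
    rw [smallestCell_eq_cellOf _ hselβ, mem_cellOf_iff] at hy'
    rw [mem_erase]
    refine ⟨fun hyx => ?_, ?_⟩
    · -- `sel I` is alone in its cell below `I`, but the cell of `β` has two vertices
      subst hyx
      have hchild : cellOf (cgChild G I (sel I)).1.1 (cgChild G I (sel I)).1.2 (sel I) = {sel I} :=
        cellOf_refineIn_indiv I.1.2 hxA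
      have hsingle : cellOf β.1.1 β.1.2 (sel I) = {sel I} := by
        rcases (mem_desc_orNode hAND hOR hx).1 hβ with rfl | hβ'
        · exact hchild
        · exact cellOf_eq_singleton_of_mem_desc sel hβ' hchild hy'.1
      have hcell : smallestCell β.1.1 β.1.2 = cellOf β.1.1 β.1.2 (sel I) := smallestCell_eq_cellOf _ hy
      have : (smallestCell β.1.1 β.1.2).card = 1 := by rw [hcell, hsingle, card_singleton]
      omega
    · have hyI : I.1.2 y = I.1.2 (sel β) := href y hy'.1 (sel β) (smallestCell_subset _ _ hselβ) hy'.2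
      rw [smallestCell_eq_cellOf _ hβC, mem_cellOf_iff]
      exact ⟨hsub hy'.1, hyI⟩
  have hcard := card_le_card hCsub
  rw [card_erase_of_mem hx] at hcard
  omega

/-- The heights of the canonical selector stay below `|V|`. -/
theorem hgt_cgSel_lt_card [Fintype V] (I : CGInst V) : hgt G cgSel I < Fintype.card V := by
  have h := hgt_le_card_smallestCell_sub_one (G := G) cgSel_mem I
  have hC : (smallestCell I.1.1 I.1.2).card ≤ Fintype.card V := card_le_univ _
  have hpos : 0 < Fintype.card V := Fintype.card_pos_iff.2 ⟨I.2.choose⟩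
  omega

/-- **Completeness with heights as values and value range `|V|`**: admissibility is the only hypothesis left. -/
theorem cg_val_ne_none_of_reach_hgt' [Fintype V] (adm : CertifiedLabels.Label V → Prop) (I₀ : CGInst V)
    (hadm : ∀ I X lam, CertifiedLabels.Reach (cgProcess G) (cgSel (V := V)) (hgt G cgSel) I₀ I X lam → adm ⟨I.1.1, X, lam⟩)
    (I : CGInst V) (X : Finset V) (lam : V → ℕ)
    (h : CertifiedLabels.Reach (cgProcess G) (cgSel (V := V)) (hgt G cgSel) I₀ I X lam) :
    CertifiedLabels.val (cgProcess G) (cgValuation G) (fun L => CertifiedLabels.replay (cgProcess G) L I₀ ∅) adm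
      (Fintype.card V) ⟨I.1.1, X, lam⟩ ≠ none :=
  cg_val_ne_none_of_reach_hgt adm _ I₀ hadm (fun I _ _ _ => hgt_cgSel_lt_card I) I X lam h

end BranchSum

end Summit.PneNP.PneNP.Theorems
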